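import Literature.Topology.FourManifolds.GluckTwistMeridian
import Literature.AlgebraicTopology.SingularHomology.MayerVietorisCriteria
import Literature.AlgebraicTopology.SingularHomology.ExcisionMayerVietorisProofs
import Literature.AlgebraicTopology.SingularHomology.SphereComplement
import Literature.AlgebraicTopology.SingularHomology.UniverseTransport
import HarnessLib

/-!
# `H₂` of a Gluck twist vanishes — proved; the Gluck twist fact from `spc4.S10` + Freedman

Sibling file of `GluckTwist.lean` / `GluckTwistHomology.lean` / `GluckTwistMeridian.lean` in the
decomposition (D-0014 provefact, XL) of the target fact
`Literature.Topology.FourManifolds.nonempty_homeomorph_sphere_of_isGluckTwist` (`Σ_K ≃ₜ S⁴` for every Gluck twist `Σ_K` of `S⁴`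
along a 2-knot `K`; Gluck, Trans. AMS 104 (1962), §17, with Freedman, J. Differential Geom. 17
(1982), Thm. 1.6).

`GluckTwistHomology.lean` proved the leaf `H₂(Σ_K; ℤ) = 0`
(`isZero_singularHomologyZ_two_of_isGluckTwist`, Gluck 1962, §17) at universe `0` *modulo* five
named facts about Mathlib's singular homology
(excision, Mayer–Vietoris exactness `exact₂`/`exact₃`, the homology of spheres — Hatcher Thm. 2.20,
§2.2, Cor. 2.14 — and Hatcher's Prop. 2B.1(b), `H̃_*(Sⁿ ∖ h(Sᵏ))`). Since then the trunk files
`Literature.AlgebraicTopology.SingularHomology.LocalHomology`/`…ExcisionMayerVietorisProofs`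
have **proved** excision, the
Mayer–Vietoris short exact sequence of the subcomplexes of small chains (`Literature.AlgebraicTopology.SingularHomology.mvSES_shortExact`,
`mvUnionHomologyIso`, `mvInterHomologyIso`, `isZero_of_mv`) and `Hⱼ(ℝᵏ ∖ 0) = 0` for `j ≥ 1`,
`j + 1 ≠ k` (`isZero_homology_punctured`, `isZero_homology_punctured_of_succ_ne`), for the
concrete singular chain complex
`Literature.csingularChainComplex R M X` of `…SingularChainsConcrete`, which is isomorphic to Mathlib's
(`csingularHomology.compIso : csingularHomology R M X n ≅ singularHomology R M X n`). This file
redoes the two Mayer–Vietoris steps of `GluckTwistHomology.lean` in that concrete model and so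
**proves the `H₂` leaf outright** — **`isZero_singularHomologyZ_two_of_isGluckTwist_holds`**
discharges the named fact at every universe — and with it reduces the target fact to exactly two
external named facts of `SPC4Wave0.lean`: the `π₁`/`H₂` characterisation of homotopy 4-spheres
`SPC4.nonempty_homotopyEquiv_sphere_four_iff` (spc4.S10) and Freedman's theorem
`SPC4.nonempty_homeomorph_sphere_four` (spc4.S04):
`nonempty_homeomorph_sphere_of_isGluckTwist_of_spc4`.

## Contents

The general homological input is in the trunk (all proved): the Mayer–Vietoris criteria
`isZero_csingularHomology_union_of_mono` (1.1), `mono_csingularHomology_map_subsetInclusion_inter`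
(1.2), `isZero_csingularHomology_of_union_of_inter` (1.3) for open covers `A ∪ B`
(`…SingularHomology.MayerVietorisCriteria`), `isZero_of_mv` (`…LocalHomology`), and
**`H₁(ℝ⁴ ∖ 0) = 0`** (`= H₁(S³)`; `isZero_homology_punctured_of_succ_ne` of
`…ExcisionMayerVietorisProofs`, the only sphere-homology input of the argument below),
`H₂(ℝ² ∖ 0) = 0` (`isZero_homology_punctured`, `…LocalHomology`) and the punctured-sphere
homeomorphism `SphereComplement.sphereMinusPointHomeomorph` (`…SphereComplement`). Here:

0. From `…SingularHomology.UniverseTransport`: `csingularHomology.isZero_of_homeomorph`,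
   vanishing of concrete singular homology is invariant under homeomorphisms *across universes*
   (proved elementwise on cycles and boundaries).

1. **`S⁴ ∖ {K(s)} = (S⁴ ∖ K) ∪ ν(D₊ × ℝ²)`** for a 2-knot `K` with tubular neighbourhood `ν` and
   `D₊ = S² ∖ {s}`: the union is a punctured 4-sphere (contractible), `ν(D₊ × ℝ²)` is
   contractible and the intersection is `ν(D₊ × (ℝ² ∖ 0)) ≃ ℝ² ∖ 0`. Hence (criterion 1.3)
   **`H₂(S⁴ ∖ K; M) = 0`** (`TwoKnot.TubularNbhd.isZero_csingularHomology_complement_two` —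
   the case `(4, 2, 2)` of
   Hatcher's Prop. 2B.1(b) for tubed knots, which `GluckTwistHomology.lean` had to assume and
   which `…SphereComplement` proves for arbitrary embeddings but modulo the *named*
   Mathlib-model Mayer–Vietoris/excision facts `hexc`, `h₃`) and
   (criterion 1.2) **`H₁(D₊ × (ℝ² ∖ 0)) → H₁(S⁴ ∖ K)` is injective**
   (`mono_csingularHomology_map_modelInclusion_one`, replacing `mono_map_toComplement_one` and its
   `H₂(S⁴) = 0`, `H₁(S²) = 0` inputs).
2. **The Gluck twist** `X = jA(S⁴ ∖ K) ∪ jB(S² × ℝ²)` (`Literature.Topology.FourManifolds.GluckDatum` of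
   `GluckTwistHomology.lean`, whose set-theoretic identities `range_jA_inter_pieceB`,
   `pieceW_inter_pieceB`, `pieceW_union_pieceB` and model homeomorphisms are reused): step 1
   `GluckDatum.isZero_csingularHomology_pieceW_two` (`H₂(W) = 0` for
   `W = jA(S⁴ ∖ K) ∪ jB(D₊ × ℝ²)`, criterion 1.1 with 1), step 2
   `GluckDatum.isZero_csingularHomology_two` (`H₂(X) = 0`, `isZero_of_mv` with
   `W ∩ jB(D₋ × ℝ²) ≅ ℝ⁴ ∖ pt` and `H₁(ℝ⁴ ∖ 0) = 0`), the comparison with Mathlib's singular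
   homology `GluckDatum.isZero_singularHomology_degree_two`, the leaf at universe `0`
   `isZero_singularHomologyZ_two_of_isGluckTwist_univ_zero` and, by the `Shrink` transport of the
   Gluck structure (`GluckTwistMeridian.lean`) with 0, the discharge
   **`isZero_singularHomologyZ_two_of_isGluckTwist_holds`** at every universe.
3. **Assembly**: `nonempty_homotopyEquiv_sphere_of_isGluckTwist_of_spc4` (`Σ_K ≃ₕ S⁴` from
   spc4.S10 alone), `nonempty_homeomorph_sphere_of_isGluckTwist_of_spc4` (the target fact at
   universe `u` from spc4.S10 + Freedman at universe `u`),
   `nonempty_homeomorph_sphere_of_isGluckTwist_of_spc4_univ_zero` (the target fact at every universe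
   from the universe-`0` instances, via the universe lift of `GluckTwistMeridian.lean`) and the
   route fact `gluck_homeomorph_sphere_four_of_spc4`.

After this file the DAG of `nonempty_homeomorph_sphere_of_isGluckTwist` reads: compactness
(`GluckTwistProofs.lean`) ✓, `π₁ = 1` (`GluckTwistMeridian.lean`, Kervaire's lemma via van Kampen)
✓, `H₂ = 0` (this file, every universe) ✓, universe lift ✓; remaining leaves: spc4.S10 (Hurewicz +
Whitehead + Poincaré duality for closed topological 4-manifolds) and Freedman's theorem (spc4.S04),
neither of which is specific to Gluck twists: `nonempty_homeomorph_sphere_of_isGluckTwist_holds`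
would be `nonempty_homeomorph_sphere_of_isGluckTwist_of_spc4 hS10 hF` once those two are theorems.

## References

* H. Gluck, *The embedding of two-spheres in the four-sphere*, Trans. Amer. Math. Soc. 104 (1962)
  308–333, §17 [GluckTAMS1962].
* A. Hatcher, *Algebraic Topology*, CUP 2002, §2.2 (Mayer–Vietoris, pp. 149–150); Cor. 2.14;
  §2.B Prop. 2B.1(b) [HatcherAT2002].
* R. Gompf, A. Stipsicz, *4-Manifolds and Kirby Calculus* (1999), §6.2, Ex. 6.2.2.
* M. Freedman, *The topology of four-dimensional manifolds*, J. Differential Geom. 17 (1982),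
  Thm. 1.6 [FreedmanJDG1982].

## Design notes

* Universe: the comparison isomorphisms `csingularHomology.mapIso`/`isoOfHomotopyEquiv` need both
  spaces in one universe and the models `S⁴ ∖ K`, `D₊ × (ℝ² ∖ 0)`, `ℝ⁴ ∖ 0` live in `Type`, so the
  Mayer–Vietoris argument runs for `X : Type`; a Gluck twist `X : Type u` is then replaced by its
  small copy `Shrink.{0} X` (with the Gluck structure transported as in `GluckTwistMeridian.lean`)
  and the vanishing of `H₂` is moved back along `Shrink.{0} X ≃ₜ X` by the elementwise,
  cross-universe `csingularHomology.isZero_of_homeomorph` (no isomorphism between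
  `ModuleCat.{0}`- and `ModuleCat.{u}`-valued homology groups being available).
  `SPC4.singularHomologyZ X 2` is definitionally `singularHomology ℤ ℤ X 2`.
* Coefficients: everything up to the leaf is proved for an arbitrary coefficient module `M` over a
  commutative ring `R`; the leaf specialises to `ℤ`.
* No declaration in this file uses `sorry`; nothing is asserted (no new named facts).
-/

noncomputable section

open CategoryTheory Limits Set Function
open scoped Topology Manifold ContDiff

universe u v

namespace Literature.Topology.FourManifolds

variable (R : Type v) [CommRing R] (M : Type v) [AddCommGroup M] [Module R M]

/-- Local notation: `𝔼 n` is the model Euclidean space `EuclideanSpace ℝ (Fin n)`. -/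
local notation "𝔼 " n:arg => EuclideanSpace ℝ (Fin n)

/-- Local notation: `𝕊 n` is the unit sphere in `EuclideanSpace ℝ (Fin (n + 1))`. -/
local notation "𝕊 " n:arg => (Metric.sphere (0 : EuclideanSpace ℝ (Fin (n + 1))) 1)

open SphereTwo

/-! ### The models `S₊ ≃ ℝ² ∖ 0` and `T ≃ ℝ⁴ ∖ 0` -/

section Models

/-- **`H₂(S₊; M) = 0`** for the model `S₊ = (S² ∖ {s}) × (ℝ² ∖ 0) ≃ ℝ² ∖ 0` of
`GluckTwistHomology.lean` (`GluckDatum.modelS`): drop the contractible factor and use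
`H₂(ℝ² ∖ 0) = 0` (`isZero_homology_punctured`, Hatcher 2002, Cor. 2.14).
[cite: HatcherAT2002, Cor. 2.14] -/
theorem isZero_csingularHomology_modelS_two :
    IsZero (Literature.AlgebraicTopology.SingularHomology.csingularHomology R M ↥GluckDatum.modelS 2) :=
  (Literature.AlgebraicTopology.SingularHomology.isZero_homology_punctured R M 2 2 le_rfl (by norm_num)).of_iso <|
    (Literature.AlgebraicTopology.SingularHomology.csingularHomology.mapIso R M GluckDatum.modelSHomeomorph 2).trans <|
      (Literature.AlgebraicTopology.SingularHomology.csingularHomology.isoOfHomotopyEquiv R M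
        (HomotopyEquiv.sndOfContractible (↥(GluckDatum.Dplus : Set (𝕊 2))) {w : 𝔼 2 // w ≠ 0})
          2).trans
        (Literature.AlgebraicTopology.SingularHomology.csingularHomology.mapIso R M (GluckDatum.puncturedEuclideanHomeomorph 2) 2)

/-- **`H₁(T; M) = 0`** for the model `T ≅ ((S² ∖ {n}) × ℝ²) ∖ {(s, 0)} ≅ ℝ⁴ ∖ {pt}` of
`GluckTwistHomology.lean` (`GluckDatum.modelT`), by `H₁(ℝ⁴ ∖ 0) = 0`
(`isZero_homology_punctured_of_succ_ne` of `…ExcisionMayerVietorisProofs`, Hatcher 2002,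
Cor. 2.14: `H₁(S³) = 0`).
[cite: HatcherAT2002, Cor. 2.14] -/
theorem isZero_csingularHomology_modelT_one :
    IsZero (Literature.AlgebraicTopology.SingularHomology.csingularHomology R M ↥GluckDatum.modelT 1) :=
  (Literature.AlgebraicTopology.SingularHomology.isZero_homology_punctured_of_succ_ne R M 1 4 le_rfl (by norm_num)).of_iso <|
    Literature.AlgebraicTopology.SingularHomology.csingularHomology.mapIso R M (GluckDatum.modelTHomeomorph.trans <|
      GluckDatum.puncturedProdHomeomorph.trans <| (GluckDatum.puncturedProdHomeomorph' _).trans <|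
        GluckDatum.puncturedProdHomeomorphEuclidean.trans
          (GluckDatum.puncturedEuclideanHomeomorph 4)) 1

end Models

/-! ### `S⁴ ∖ {K(s)} = (S⁴ ∖ K) ∪ ν((S² ∖ {s}) × ℝ²)`: `H₂(S⁴ ∖ K) = 0` and `H₁`-injectivity -/

section SphereFour

variable {K : TwoKnot}

namespace TwoKnot.TubularNbhd

/-- The cap `ν((S² ∖ {s}) × ℝ²)`: the tube over the punctured sphere `D₊ = S² ∖ {south pole}`.
[folklore] -/
def capPlus (ν : TwoKnot.TubularNbhd K) : Set (𝕊 4) :=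
  ν.toFun '' ((GluckDatum.Dplus : Set (𝕊 2)) ×ˢ (univ : Set (𝔼 2)))

/-- The cap is open. [folklore] -/
theorem isOpen_capPlus (ν : TwoKnot.TubularNbhd K) : IsOpen ν.capPlus :=
  ν.isOpen_image (isOpen_compl_singleton.prod isOpen_univ)

/-- `(S⁴ ∖ K) ∪ ν(D₊ × ℝ²) = S⁴ ∖ {K(s)}`. [folklore] -/
theorem compl_range_union_capPlus (ν : TwoKnot.TubularNbhd K) :
    (range K)ᶜ ∪ ν.capPlus = {K southPole}ᶜ := by
  ext a
  simp only [mem_union, mem_compl_iff, mem_range, not_exists, mem_singleton_iff]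
  constructor
  · rintro (ha | ⟨⟨y, w⟩, ⟨hy, -⟩, rfl⟩) h
    · exact ha southPole h.symm
    · rw [← ν.apply_zero] at h
      exact hy (congrArg Prod.fst (ν.injective h))
  · intro ha
    by_cases h : ∃ y, K y = a
    · obtain ⟨y, rfl⟩ := h
      refine Or.inr ⟨(y, 0), ⟨fun hy => ha ?_, mem_univ _⟩, ν.apply_zero y⟩
      have hy' : y = southPole := hy
      rw [hy']
    · exact Or.inl fun y hy => h ⟨y, hy⟩

/-- `(S⁴ ∖ K) ∩ ν(D₊ × ℝ²) = ν(S₊)` with `S₊ = {(x, w) | x ≠ s, w ≠ 0}`. [folklore] -/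
theorem compl_range_inter_capPlus (ν : TwoKnot.TubularNbhd K) :
    (range K)ᶜ ∩ ν.capPlus = range (fun p : ↥GluckDatum.modelS => ν.toFun p.1.1) := by
  ext a
  constructor
  · rintro ⟨ha, ⟨⟨y, w⟩, ⟨hy, -⟩, rfl⟩⟩
    have hw : w ≠ 0 := by
      rintro rfl
      exact ha ⟨y, (ν.apply_zero y).symm⟩
    exact ⟨⟨⟨(y, w), hw⟩, hy⟩, rfl⟩
  · rintro ⟨⟨⟨⟨y, w⟩, hw⟩, hy⟩, rfl⟩
    exact ⟨ν.apply_mem_compl_range y hw, ⟨(y, w), ⟨hy, mem_univ _⟩, rfl⟩⟩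

/-- `(S⁴ ∖ K) ∪ ν(D₊ × ℝ²) = S⁴ ∖ {pt} ≃ₜ ℝ⁴` is contractible (stereographic projection,
`Literature.AlgebraicTopology.SingularHomology.SphereComplement.sphereMinusPointHomeomorph`). [folklore] -/
instance contractibleSpace_compl_range_union_capPlus (ν : TwoKnot.TubularNbhd K) :
    ContractibleSpace ↥((range K)ᶜ ∪ ν.capPlus) :=
  ((Homeomorph.setCongr ν.compl_range_union_capPlus).trans
    (Literature.AlgebraicTopology.SingularHomology.SphereComplement.sphereMinusPointHomeomorph (K southPole))).contractibleSpace

/-- `ν(D₊ × ℝ²) ≅ D₊ × ℝ²` is contractible. [folklore] -/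
instance contractibleSpace_capPlus (ν : TwoKnot.TubularNbhd K) : ContractibleSpace ↥ν.capPlus :=
  (ν.isSmoothEmbedding.isEmbedding.homeomorphImage _).symm.contractibleSpace

/-- The model embedding `S₊ → S⁴`, `p ↦ ν p`. [folklore] -/
theorem isEmbedding_modelS_val (ν : TwoKnot.TubularNbhd K) :
    Topology.IsEmbedding (fun p : ↥GluckDatum.modelS => ν.toFun p.1.1) :=
  ν.isSmoothEmbedding.isEmbedding.comp
    (Topology.IsEmbedding.subtypeVal.comp Topology.IsEmbedding.subtypeVal)

/-- `S₊ ≃ₜ (S⁴ ∖ K) ∩ ν(D₊ × ℝ²)` via `ν`. [folklore] -/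
def modelSHomeomorphInter (ν : TwoKnot.TubularNbhd K) :
    ↥GluckDatum.modelS ≃ₜ ↥((range K)ᶜ ∩ ν.capPlus) :=
  ν.isEmbedding_modelS_val.toHomeomorph.trans (Homeomorph.setCongr ν.compl_range_inter_capPlus.symm)

/-- **`H₂(S⁴ ∖ K(S²); M) = 0`** for a 2-knot with a tubular neighbourhood: Mayer–Vietoris for
`S⁴ ∖ {K(s)} = (S⁴ ∖ K) ∪ ν(D₊ × ℝ²)` (exactness at `H₂(S⁴ ∖ K) ⊕ H₂(ν(D₊ × ℝ²))`,
`isZero_csingularHomology_of_union_of_inter`): the union is `S⁴` minus a point (contractible) and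
the intersection is `ν(D₊ × (ℝ² ∖ 0)) ≃ ℝ² ∖ 0`, with `H₂(ℝ² ∖ 0) = 0`. This is the case
`(n, k, i) = (4, 2, 2)` of Hatcher 2002, Prop. 2B.1(b), for tubed (e.g. smooth) knots.
[cite: HatcherAT2002, §2.2 p. 149] -/
theorem isZero_csingularHomology_complement_two (ν : TwoKnot.TubularNbhd K) :
    IsZero (Literature.AlgebraicTopology.SingularHomology.csingularHomology R M K.complement 2) :=
  Literature.AlgebraicTopology.SingularHomology.isZero_csingularHomology_of_union_of_inter R M K.isClosed_range.isOpen_compl ν.isOpen_capPlus 2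
    (Literature.AlgebraicTopology.SingularHomology.isZero_csingularHomology_of_contractibleSpace R M two_ne_zero)
    ((isZero_csingularHomology_modelS_two R M).of_iso
      (Literature.AlgebraicTopology.SingularHomology.csingularHomology.mapIso R M ν.modelSHomeomorphInter 2).symm)

/-- **`H₁` of the punctured cap injects into `H₁` of the knot complement**: the model inclusion
`S₊ = D₊ × (ℝ² ∖ 0) → S⁴ ∖ K(S²)`, `p ↦ ν p` (this is `G.modelInclusion` of
`GluckTwistHomology.lean` for any Gluck datum `G` with `G.ν = ν`), is a monomorphism on `H₁(−; M)`:
Mayer–Vietoris for `S⁴ ∖ {K(s)} = (S⁴ ∖ K) ∪ ν(D₊ × ℝ²)`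
(`mono_csingularHomology_map_subsetInclusion_inter`) with `H₂(S⁴ ∖ pt) = 0` and
`H₁(ν(D₊ × ℝ²)) = 0` (both contractible).
[cite: HatcherAT2002, §2.2 p. 149] -/
theorem mono_csingularHomology_map_modelInclusion_one (ν : TwoKnot.TubularNbhd K) :
    Mono (Literature.AlgebraicTopology.SingularHomology.csingularHomology.map R M
      (ν.toComplement.comp ⟨Subtype.val, continuous_subtype_val⟩ :
        C(↥GluckDatum.modelS, K.complement)) 1) := by
  have hm := Literature.AlgebraicTopology.SingularHomology.mono_csingularHomology_map_subsetInclusion_inter R M K.isClosed_range.isOpen_compl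
    ν.isOpen_capPlus 1
    (Literature.AlgebraicTopology.SingularHomology.isZero_csingularHomology_of_contractibleSpace R M two_ne_zero)
    (Literature.AlgebraicTopology.SingularHomology.isZero_csingularHomology_of_contractibleSpace R M one_ne_zero)
  exact Literature.AlgebraicTopology.SingularHomology.csingularHomology.mono_map_of_conj R M _ _ ν.modelSHomeomorphInter.symm
    (Homeomorph.refl K.complement) (fun x => by
      obtain ⟨p, rfl⟩ := ν.modelSHomeomorphInter.surjective x
      rw [Homeomorph.symm_apply_apply]
      rfl) 1 hm

end TwoKnot.TubularNbhd

end SphereFour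

/-! ### The Gluck twist: `H₂(Σ_K; M) = 0` (concrete homology, universe `0`) -/

section GluckTwist

variable {X : Type} [TopologicalSpace X] {K : TwoKnot}

namespace GluckDatum

/-- `jB(D₊ × ℝ²) ≅ D₊ × ℝ²` is contractible. [folklore] -/
instance contractibleSpace_pieceB_Dplus (G : GluckDatum X K) :
    ContractibleSpace ↥(G.pieceB Dplus) :=
  (G.hB.homeomorphImage _).symm.contractibleSpace

/-- `S₊ ≃ₜ jA(S⁴ ∖ K) ∩ jB(D₊ × ℝ²)` via `p ↦ jA (ν p)`. [folklore] -/
def modelSHomeomorphInter (G : GluckDatum X K) : ↥modelS ≃ₜ ↥(range G.jA ∩ G.pieceB Dplus) :=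
  G.isEmbedding_jA_toComplement.toHomeomorph.trans
    (Homeomorph.setCongr G.range_jA_inter_pieceB.symm)

/-- **Step 1: `H₂(W; M) = 0`** for `W = jA(S⁴ ∖ K) ∪ jB(D₊ × ℝ²)`, by Mayer–Vietoris
(`isZero_csingularHomology_union_of_mono`): `H₂(S⁴ ∖ K) = 0`
(`isZero_csingularHomology_complement_two`), `D₊ × ℝ²` is contractible, and
`H₁(jA(S⁴ ∖ K) ∩ jB(D₊ × ℝ²)) → H₁(jA(S⁴ ∖ K))` is injective, being modelled on `S₊ → S⁴ ∖ K`
(`mono_csingularHomology_map_modelInclusion_one`). [cite: HatcherAT2002, §2.2 p. 149] -/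
theorem isZero_csingularHomology_pieceW_two (G : GluckDatum X K) :
    IsZero (Literature.AlgebraicTopology.SingularHomology.csingularHomology R M ↥G.pieceW 2) := by
  refine Literature.AlgebraicTopology.SingularHomology.isZero_csingularHomology_union_of_mono R M G.hAo (G.isOpen_pieceB isOpen_compl_singleton) 1
    ((G.ν.isZero_csingularHomology_complement_two R M).of_iso
      (Literature.AlgebraicTopology.SingularHomology.csingularHomology.mapIso R M G.hA.toHomeomorph 2).symm)
    (Literature.AlgebraicTopology.SingularHomology.isZero_csingularHomology_of_contractibleSpace R M two_ne_zero) ?_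
  exact Literature.AlgebraicTopology.SingularHomology.csingularHomology.mono_map_of_conj R M _ _ G.modelSHomeomorphInter G.hA.toHomeomorph
    (fun _ => rfl) 1 (G.ν.mono_csingularHomology_map_modelInclusion_one R M)

/-- **Step 2: `H₂(X; M) = 0`** by Mayer–Vietoris for `X = W ∪ jB(D₋ × ℝ²)` (`isZero_of_mv`):
`H₂(W) = 0` (step 1), `jB(D₋ × ℝ²)` is contractible and
`W ∩ jB(D₋ × ℝ²) = jB((D₋ × ℝ²) ∖ {(s, 0)}) ≅ ℝ⁴ ∖ {pt}` has `H₁ = 0`.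
[cite: HatcherAT2002, §2.2 p. 149] -/
theorem isZero_csingularHomology_two (G : GluckDatum X K) : IsZero (Literature.AlgebraicTopology.SingularHomology.csingularHomology R M X 2) := by
  have h := Literature.AlgebraicTopology.SingularHomology.isZero_of_mv R M G.isOpen_pieceW (G.isOpen_pieceB isOpen_compl_singleton) 1
    (G.isZero_csingularHomology_pieceW_two R M)
    (Literature.AlgebraicTopology.SingularHomology.isZero_csingularHomology_of_contractibleSpace R M two_ne_zero)
    ((isZero_csingularHomology_modelT_one R M).of_iso
      (Literature.AlgebraicTopology.SingularHomology.csingularHomology.mapIso R M ((Homeomorph.setCongr G.pieceW_inter_pieceB).trans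
        (G.hB.homeomorphImage modelT).symm) 1))
  exact h.of_iso (Literature.AlgebraicTopology.SingularHomology.csingularHomology.mapIso R M
    ((Homeomorph.setCongr G.pieceW_union_pieceB).trans (Homeomorph.Set.univ X)) 2).symm

/-- **`H₂(X; M) = 0` for Mathlib's singular homology** (comparison isomorphism
`csingularHomology.compIso`). [cite: GluckTAMS1962, §17] -/
theorem isZero_singularHomology_degree_two (G : GluckDatum X K) :
    IsZero (Literature.AlgebraicTopology.SingularHomology.singularHomology R M X 2) :=
  (G.isZero_csingularHomology_two R M).of_iso (Literature.AlgebraicTopology.SingularHomology.csingularHomology.compIso R M X 2).symm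

end GluckDatum

/-- **Gluck 1962, §17: `H₂(Σ_K; ℤ) = 0` for every Gluck twist — proved** (universe `0`). The
leaf `isZero_singularHomologyZ_two_of_isGluckTwist.{0}` of the decomposition of
`nonempty_homeomorph_sphere_of_isGluckTwist` (`GluckTwistHomotopySphere.lean`), now without any
hypothesis: the Mayer–Vietoris sequence, excision and the homology of punctured Euclidean spaces
are theorems of `Literature.AlgebraicTopology.SingularHomology.LocalHomology`, the vanishing
`H₁(ℝ⁴ ∖ 0) = 0` is `isZero_homology_punctured_of_succ_ne` (`…ExcisionMayerVietorisProofs`),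
and `H₂(S⁴ ∖ K) = 0` is
`TwoKnot.TubularNbhd.isZero_csingularHomology_complement_two`. Argument: with `D₊ = S² ∖ {s}`,
`D₋ = S² ∖ {n}` the complements of the poles fixed by the Gluck rotations and
`W = jA(S⁴ ∖ K) ∪ jB(D₊ × ℝ²)`: (1) `H₂(W) = 0` since `H₂(S⁴ ∖ K) = 0`, `D₊ × ℝ²` is contractible
and `jA(S⁴ ∖ K) ∩ jB(D₊ × ℝ²) = jA(ν(D₊ × (ℝ² ∖ 0)))` injects on `H₁` into `jA(S⁴ ∖ K)` (both from
Mayer–Vietoris for `S⁴ ∖ {K(s)} = (S⁴ ∖ K) ∪ ν(D₊ × ℝ²)`, a contractible union with intersection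
`≃ ℝ² ∖ 0`); (2) `X = W ∪ jB(D₋ × ℝ²)` with `jB(D₋ × ℝ²)` contractible and
`W ∩ jB(D₋ × ℝ²) ≅ ℝ⁴ ∖ {pt}`, `H₁(ℝ⁴ ∖ pt) = 0`. (The printed argument, Gluck 1962 §17 /
Gompf–Stipsicz Ex. 6.2.2, is Mayer–Vietoris for `(S⁴ ∖ νK) ∪ S² × D²` with the Gluck map acting
trivially on `H_*(S² × S¹)`.) [cite: GluckTAMS1962, §17] -/
theorem isZero_singularHomologyZ_two_of_isGluckTwist_univ_zero :
    isZero_singularHomologyZ_two_of_isGluckTwist.{0} (K := K) := by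
  intro X _ _ _ _ _ h
  obtain ⟨G⟩ := h.nonempty_gluckDatum
  exact G.isZero_singularHomology_degree_two ℤ ℤ

end GluckTwist

/-! ### The `H₂` leaf at every universe: `isZero_singularHomologyZ_two_of_isGluckTwist_holds` -/

section Discharge

variable {K : TwoKnot}

/-- **Discharge of the named fact `Literature.Topology.FourManifolds.isZero_singularHomologyZ_two_of_isGluckTwist`** (Gluck 1962,
§17: `H₂(Σ_K; ℤ) = 0` for every Hausdorff second countable smooth 4-manifold `Σ_K : Type u` which
is a Gluck twist of `S⁴` along `K`), at every universe `u`. A Gluck twist `X : Type u` is small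
(`IsGluckTwist.small`), so `Shrink.{0} X : Type` is a homeomorphic copy carrying the transported
`C^∞` structure (`Homeomorph.transportChartedSpace`, `Homeomorph.isManifold_transportChartedSpace`,
`Homeomorph.transportDiffeomorph` of `GluckTwistMeridian.lean`), again a Gluck twist along `K`
(`IsGluckTwist.of_diffeomorph`); its `H₂` vanishes by the universe-`0` leaf
`isZero_singularHomologyZ_two_of_isGluckTwist_univ_zero`, and vanishing of (concrete) singular
homology is transported back along the homeomorphism across universes
(`csingularHomology.isZero_of_homeomorph`) and compared with Mathlib's model at universe `u`
(`csingularHomology.compIso`). [cite: GluckTAMS1962, §17] -/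
theorem isZero_singularHomologyZ_two_of_isGluckTwist_holds :
    isZero_singularHomologyZ_two_of_isGluckTwist.{u} (K := K) := by
  intro X _ _ _ _ _ hX
  haveI : Small.{0} X := hX.small
  let φ : X ≃ₜ Shrink.{0} X := Shrink.homeomorph X
  letI : ChartedSpace (𝔼 4) (Shrink.{0} X) := Homeomorph.transportChartedSpace φ
  haveI : IsManifold (𝓡 4) ∞ (Shrink.{0} X) :=
    Homeomorph.isManifold_transportChartedSpace (I₀ := 𝓡 4) (n := ∞) φ
  haveI : T2Space (Shrink.{0} X) := φ.t2Space
  haveI : SecondCountableTopology (Shrink.{0} X) := φ.symm.secondCountableTopology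
  have h' : IsGluckTwist (𝓡 4) (Shrink.{0} X) K :=
    hX.of_diffeomorph (Homeomorph.transportDiffeomorph (I₀ := 𝓡 4) (n := ∞) φ)
  have h0 : IsZero (Literature.AlgebraicTopology.SingularHomology.csingularHomology ℤ ℤ (Shrink.{0} X) 2) :=
    (isZero_singularHomologyZ_two_of_isGluckTwist_univ_zero h').of_iso
      (Literature.AlgebraicTopology.SingularHomology.csingularHomology.compIso ℤ ℤ _ 2)
  exact (Literature.AlgebraicTopology.SingularHomology.csingularHomology.isZero_of_homeomorph ℤ ℤ φ.symm h0).of_iso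
    (Literature.AlgebraicTopology.SingularHomology.csingularHomology.compIso ℤ ℤ X 2).symm

end Discharge

/-! ### Assembly: the target fact from `spc4.S10` and Freedman's theorem alone -/

section Assembly

variable {K : TwoKnot}

/-- **Gluck 1962, §17: a Gluck twist is a homotopy 4-sphere — reduced to `spc4.S10` alone.** With
compactness (`IsGluckTwist.compactSpace_holds`), simple connectivity
(`simplyConnectedSpace_of_isGluckTwist_holds`) and `H₂ = 0`
(`isZero_singularHomologyZ_two_of_isGluckTwist_holds`) all proved, the named fact
`nonempty_homotopyEquiv_sphere_of_isGluckTwist.{u}` (`Σ_K ≃ₕ S⁴`) follows from the `π₁`/`H₂`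
characterisation of homotopy 4-spheres `SPC4.nonempty_homotopyEquiv_sphere_four_iff.{u}`
(Freedman–Quinn 1990, §10; Hurewicz, Whitehead, Poincaré duality). [cite: GluckTAMS1962, §17] -/
theorem nonempty_homotopyEquiv_sphere_of_isGluckTwist_of_spc4
    (hS10 : FourManifolds.nonempty_homotopyEquiv_sphere_four_iff.{u}) :
    nonempty_homotopyEquiv_sphere_of_isGluckTwist.{u} (K := K) :=
  nonempty_homotopyEquiv_sphere_of_isGluckTwist_of
    (fun {_} _ _ => IsGluckTwist.compactSpace_holds)
    (fun {_} _ _ => simplyConnectedSpace_of_isGluckTwist_holds)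
    isZero_singularHomologyZ_two_of_isGluckTwist_holds hS10

/-- **The target fact from `spc4.S10` and Freedman's theorem** (same universe). For every 2-knot
`K`, `nonempty_homeomorph_sphere_of_isGluckTwist.{u}` (`Σ_K ≃ₜ S⁴` for every Gluck twist
`Σ_K : Type u` of `S⁴` along `K`; Gluck 1962, §17 with Freedman 1982, Thm. 1.6) follows from the
`π₁`/`H₂` characterisation of homotopy 4-spheres (`SPC4.nonempty_homotopyEquiv_sphere_four_iff.{u}`)
and Freedman's theorem (`SPC4.nonempty_homeomorph_sphere_four.{u}`) alone: every Gluck-specific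
input of `nonempty_homeomorph_sphere_of_isGluckTwist_of_facts` — compactness
(`GluckTwistProofs.lean`), simple connectivity (`GluckTwistMeridian.lean`), `H₂(Σ_K; ℤ) = 0` (this
file) — is proved. [cite: GluckTAMS1962, §17] [cite: FreedmanJDG1982, Thm. 1.6] -/
theorem nonempty_homeomorph_sphere_of_isGluckTwist_of_spc4
    (hS10 : FourManifolds.nonempty_homotopyEquiv_sphere_four_iff.{u})
    (hF : FourManifolds.nonempty_homeomorph_sphere_four.{u}) :
    nonempty_homeomorph_sphere_of_isGluckTwist.{u} (K := K) :=
  nonempty_homeomorph_sphere_of_isGluckTwist_of_homology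
    isZero_singularHomologyZ_two_of_isGluckTwist_holds hS10 hF

/-- **The target fact at every universe from the universe-`0` instances of `spc4.S10` and
Freedman's theorem**, by the universe lift `nonempty_homeomorph_sphere_of_isGluckTwist_of_univ_zero`
of `GluckTwistMeridian.lean`. [cite: GluckTAMS1962, §17] [cite: FreedmanJDG1982, Thm. 1.6] -/
theorem nonempty_homeomorph_sphere_of_isGluckTwist_of_spc4_univ_zero
    (hS10 : FourManifolds.nonempty_homotopyEquiv_sphere_four_iff.{0})
    (hF : FourManifolds.nonempty_homeomorph_sphere_four.{0}) :
    nonempty_homeomorph_sphere_of_isGluckTwist.{u} (K := K) :=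
  nonempty_homeomorph_sphere_of_isGluckTwist_of_univ_zero
    (nonempty_homeomorph_sphere_of_isGluckTwist_of_spc4 hS10 hF)

/-- **The route fact `gluck_homeomorph_sphere_four` from `spc4.S10` and Freedman's theorem.**
[cite: GluckTAMS1962, §17] [cite: FreedmanJDG1982, Thm. 1.6] -/
theorem gluck_homeomorph_sphere_four_of_spc4
    (hS10 : FourManifolds.nonempty_homotopyEquiv_sphere_four_iff.{0})
    (hF : FourManifolds.nonempty_homeomorph_sphere_four.{0}) : gluck_homeomorph_sphere_four :=
  gluck_homeomorph_sphere_four_of fun _ =>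
    nonempty_homeomorph_sphere_of_isGluckTwist_of_spc4 hS10 hF

end Assembly

end Literature.Topology.FourManifolds

end
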